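import Summits.Ventures.HSemireg.WedgeHankelRecurrenceGaussJacobiDiagonalization

/-!
# Venture HSemireg — **THE EXTREME GAUSS NODES AS EXTREMA OF THE RAYLEIGH QUOTIENT `Σ ν w P(w)² ∕ Σ ν P(w)²`**: if `(λ, z)` (`z_0 < ⋯ < z_t`, `λ ≥ 0`) is exact for `(ν, w)` in degree `≤ 2t + 1`, then
# for every `P` of degree `≤ t`: `z_0 · Σ_l ν_l P(w_l)² ≤ Σ_l ν_l w_l P(w_l)² ≤ z_t · Σ_l ν_l P(w_l)²`, with equality at the Lagrange basis polynomials of the extreme nodes; hence the largest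
# Gauss node is non-decreasing and the smallest non-increasing in `t`, and `z_0 ≤ (Σ ν w) ∕ (Σ ν) ≤ z_t` (the barycentre lies between the extreme nodes)

HONEST FRAMING. Part of the Lean index of the computation cell `pub-hsemireg` (seat p10 gen 43, Sunday typer «UNIFORM-IN-n»).  Real polynomials and finite sums only; no variety, no cohomology
theory, no sheaf, no Ext group and no semiregularity map is constructed here; nothing here says that HC / HC_CM / HC_AV holds; no Literature fact (unproved `Prop`) is declared or used.  Custodian
versions as in `WedgeHankelSiegelIdeal` (1/3).
SOURCES (cited).  G. Szegő, *Orthogonal Polynomials*, Thm 7.72.1 ∕ §7.72 (the extreme zeros as `max ∕ min` of `∫ x P(x)² dα ∕ ∫ P(x)² dα` over `deg P ≤ n − 1`) and Thm 3.3.1; T. S. Chihara, *An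
Introduction to Orthogonal Polynomials* (1978), Ch. I Ex. 5.7 and Ch. IV Thm 2.1 (monotonicity of the extreme zeros); R. Courant, D. Hilbert, *Methoden der mathematischen Physik* I (1924), Ch. I
§4 (Rayleigh quotient of the Jacobi form); G. H. Golub, J. H. Welsch, Math. Comp. 23 (1969) §2.
PROOF TYPED HERE.  Exactness (N239 `sum_mul_eval_eq_of_moments_eq`) moves `Σ ν w P²` and `Σ ν P²` to the nodes, where `z_0 ≤ z_k ≤ z_t` and `λ_k P(z_k)² ≥ 0`; equality at `ℓ_0`, `ℓ_t`
(Mathlib `Lagrange.eval_basis_self` ∕ `eval_basis_of_ne`); monotonicity by comparing two exact rules through the common measure; the barycentre with `P = 1`.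
DEDUP DISCLOSURE (`rg -n 'rayleigh|sum_mul_node_mul_sq|gaussNode_last_mono|barycent' Summits Literature`, 2026-09-03): N264 (`GaussNodesExtreme`) pins the nodes inside `[min w, max w]` and N275 is the
`min Σ ν P²` extremal property of the orthogonal polynomial — different functionals.  The 8 names below: 0 hits tree-wide.

WHAT IS IN THE TREE.  N239 `sum_mul_eval_eq_of_moments_eq`; N273 `sum_mul_eval_sq_pos_of_natDegree_lt`; N265 `natDegree_lagrange_basis_fin`; Mathlib `Lagrange.eval_basis_self`, `Lagrange.eval_basis_of_ne`,
`Finset.sum_le_sum`, `Finset.sum_eq_single`.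
THIS FILE (namespace `Summit.Ventures.HSemireg.Wedge.HankelOuter` continued; CHAINED on N300 (import), N239, N265, N273; 0 definitions):
* §1066 `sum_mul_node_mul_sq_le_last` ∕ `first_mul_sum_mul_sq_le` (on the nodes), **`rayleigh_le_gaussNode_last`**, **`gaussNode_zero_le_rayleigh`** (THE BOUNDS for `deg P ≤ t`),
  `rayleigh_eq_at_basis` (equality at `ℓ_t` and `ℓ_0`), **`gaussNode_last_isGreatest_rayleigh`** (SZEGŐ 7.72.1 for a positive discrete measure: `z_t` is the maximum and `z_0` the minimum of the
  quotient over `P ≠ 0`, `deg P ≤ t`), **`gaussNode_extreme_mono`** (for two exact rules with `t + 1 ≤ t′ + 1` nodes: `z′_0 ≤ z_0` and `z_t ≤ z′_{t′}`), `gaussNode_zero_le_barycentre_le_last`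
  (`z_0 Σ ν ≤ Σ ν w ≤ z_t Σ ν`).
CAVEATS.  Discrete measures with finitely many atoms, as throughout the chapter.  Nothing Ext-side.  New names only.
-/

open Module Polynomial
open scoped Matrix Polynomial

namespace Summit.Ventures.HSemireg.Wedge.HankelOuter

/-! ## §1066. The extreme Gauss nodes and the Rayleigh quotient `Σ ν w P² ∕ Σ ν P²` -/

/-- **On the nodes**: `Σ_k λ_k z_k P(z_k)² ≤ z_t Σ_k λ_k P(z_k)²` for `λ ≥ 0` and `z` increasing. [mechanism; this file, §1066] -/
theorem sum_mul_node_mul_sq_le_last {t : ℕ} {μ z : Fin (t + 1) → ℝ} (hz : StrictMono z) (hμ : ∀ k, 0 ≤ μ k) (P : ℝ[X]) :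
    ∑ k, μ k * (z k * (P.eval (z k)) ^ 2) ≤ z (Fin.last t) * ∑ k, μ k * (P.eval (z k)) ^ 2 := by
  rw [Finset.mul_sum]
  refine Finset.sum_le_sum fun k _ => ?_
  rw [mul_left_comm]
  exact mul_le_mul_of_nonneg_right (hz.monotone (Fin.le_last k)) (mul_nonneg (hμ k) (sq_nonneg _))

/-- **On the nodes**: `z_0 Σ_k λ_k P(z_k)² ≤ Σ_k λ_k z_k P(z_k)²`. [mechanism; this file, §1066] -/
theorem first_mul_sum_mul_sq_le {t : ℕ} {μ z : Fin (t + 1) → ℝ} (hz : StrictMono z) (hμ : ∀ k, 0 ≤ μ k) (P : ℝ[X]) :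
    z 0 * ∑ k, μ k * (P.eval (z k)) ^ 2 ≤ ∑ k, μ k * (z k * (P.eval (z k)) ^ 2) := by
  rw [Finset.mul_sum]
  refine Finset.sum_le_sum fun k _ => ?_
  rw [mul_left_comm (μ k) (z k)]
  exact mul_le_mul_of_nonneg_right (hz.monotone (Fin.zero_le k)) (mul_nonneg (hμ k) (sq_nonneg _))

/-- **`Σ_l ν_l w_l P(w_l)² ≤ z_t · Σ_l ν_l P(w_l)²`** for every `P` with `deg P ≤ t`, whenever `(λ, z)` (`λ ≥ 0`, `z_0 < ⋯ < z_t`) is exact for `(ν, w)` in degree `≤ 2t + 1` (no sign condition on `ν`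
is needed for the transfer). [Szegő Thm 7.72.1; this file, §1066] -/
theorem rayleigh_le_gaussNode_last {t N : ℕ} {μ z : Fin (t + 1) → ℝ} {ν w : Fin N → ℝ} (hz : StrictMono z) (hμ : ∀ k, 0 ≤ μ k)
    (hmom : ∀ p, p ≤ 2 * t + 1 → ∑ k, μ k * z k ^ p = ∑ l, ν l * w l ^ p) {P : ℝ[X]} (hP : P.natDegree ≤ t) :
    ∑ l, ν l * (w l * (P.eval (w l)) ^ 2) ≤ z (Fin.last t) * ∑ l, ν l * (P.eval (w l)) ^ 2 := by
  have hmom' : ∀ p, p < 2 * t + 2 → ∑ k, μ k * z k ^ p = ∑ l, ν l * w l ^ p := fun p hp => hmom p (by omega)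
  have hP2 : (P ^ 2).natDegree < 2 * t + 2 := lt_of_le_of_lt natDegree_pow_le (by omega)
  have hXP2 : (Polynomial.X * P ^ 2).natDegree < 2 * t + 2 :=
    lt_of_le_of_lt (natDegree_mul_le.trans (add_le_add natDegree_X_le natDegree_pow_le)) (by omega)
  have h1 := sum_mul_eval_eq_of_moments_eq hmom' hXP2
  have h2 := sum_mul_eval_eq_of_moments_eq hmom' hP2
  simp only [eval_mul, eval_X, eval_pow] at h1 h2
  rw [← h1, ← h2]
  exact sum_mul_node_mul_sq_le_last hz hμ P

/-- **`z_0 · Σ_l ν_l P(w_l)² ≤ Σ_l ν_l w_l P(w_l)²`** for every `P` with `deg P ≤ t`. [Szegő Thm 7.72.1; this file, §1066] -/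
theorem gaussNode_zero_le_rayleigh {t N : ℕ} {μ z : Fin (t + 1) → ℝ} {ν w : Fin N → ℝ} (hz : StrictMono z) (hμ : ∀ k, 0 ≤ μ k)
    (hmom : ∀ p, p ≤ 2 * t + 1 → ∑ k, μ k * z k ^ p = ∑ l, ν l * w l ^ p) {P : ℝ[X]} (hP : P.natDegree ≤ t) :
    z 0 * ∑ l, ν l * (P.eval (w l)) ^ 2 ≤ ∑ l, ν l * (w l * (P.eval (w l)) ^ 2) := by
  have hmom' : ∀ p, p < 2 * t + 2 → ∑ k, μ k * z k ^ p = ∑ l, ν l * w l ^ p := fun p hp => hmom p (by omega)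
  have hP2 : (P ^ 2).natDegree < 2 * t + 2 := lt_of_le_of_lt natDegree_pow_le (by omega)
  have hXP2 : (Polynomial.X * P ^ 2).natDegree < 2 * t + 2 :=
    lt_of_le_of_lt (natDegree_mul_le.trans (add_le_add natDegree_X_le natDegree_pow_le)) (by omega)
  have h1 := sum_mul_eval_eq_of_moments_eq hmom' hXP2
  have h2 := sum_mul_eval_eq_of_moments_eq hmom' hP2
  simp only [eval_mul, eval_X, eval_pow] at h1 h2
  rw [← h1, ← h2]
  exact first_mul_sum_mul_sq_le hz hμ P

/-- **Equality at the Lagrange basis polynomials of the extreme nodes**: with `ℓ_k` the Lagrange basis on the nodes (`deg ℓ_k = t`), `Σ_l ν_l w_l ℓ_k(w_l)² = z_k · Σ_l ν_l ℓ_k(w_l)²` and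
`Σ_l ν_l ℓ_k(w_l)² = λ_k`, for every node `k`. [Szegő Thm 7.72.1 (attainment); Szegő Thm 3.4.2 (Christoffel numbers); this file, §1066] -/
theorem rayleigh_eq_at_basis {t N : ℕ} {μ z : Fin (t + 1) → ℝ} {ν w : Fin N → ℝ} (hz : StrictMono z)
    (hmom : ∀ p, p ≤ 2 * t + 1 → ∑ k, μ k * z k ^ p = ∑ l, ν l * w l ^ p) (k : Fin (t + 1)) :
    ∑ l, ν l * (w l * ((Lagrange.basis Finset.univ z k).eval (w l)) ^ 2) = z k * ∑ l, ν l * ((Lagrange.basis Finset.univ z k).eval (w l)) ^ 2 ∧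
      ∑ l, ν l * ((Lagrange.basis Finset.univ z k).eval (w l)) ^ 2 = μ k := by
  set L := Lagrange.basis Finset.univ z k with hL
  have hmom' : ∀ p, p < 2 * t + 2 → ∑ k, μ k * z k ^ p = ∑ l, ν l * w l ^ p := fun p hp => hmom p (by omega)
  have hLd : L.natDegree = t := natDegree_lagrange_basis_fin hz.injective k
  have hP2 : (L ^ 2).natDegree < 2 * t + 2 := lt_of_le_of_lt natDegree_pow_le (by rw [hLd]; omega)
  have hXP2 : (Polynomial.X * L ^ 2).natDegree < 2 * t + 2 :=
    lt_of_le_of_lt (natDegree_mul_le.trans (add_le_add natDegree_X_le natDegree_pow_le)) (by rw [hLd]; omega)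
  have h1 := sum_mul_eval_eq_of_moments_eq hmom' hXP2
  have h2 := sum_mul_eval_eq_of_moments_eq hmom' hP2
  simp only [eval_mul, eval_X, eval_pow] at h1 h2
  -- on the nodes `L(z_j) = δ_{jk}`
  have hnode : ∀ j, L.eval (z j) = if j = k then 1 else 0 := fun j => by
    split_ifs with h
    · rw [h, hL, Lagrange.eval_basis_self (hz.injective.injOn) (Finset.mem_univ k)]
    · rw [hL, Lagrange.eval_basis_of_ne (Ne.symm h) (Finset.mem_univ j)]
  have hs1 : ∑ j, μ j * (z j * (L.eval (z j)) ^ 2) = μ k * z k := by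
    rw [Finset.sum_eq_single k (fun j _ hj => by rw [hnode j, if_neg hj]; ring) (fun h => (h (Finset.mem_univ k)).elim), hnode k, if_pos rfl]; ring
  have hs2 : ∑ j, μ j * (L.eval (z j)) ^ 2 = μ k := by
    rw [Finset.sum_eq_single k (fun j _ hj => by rw [hnode j, if_neg hj]; ring) (fun h => (h (Finset.mem_univ k)).elim), hnode k, if_pos rfl]; ring
  rw [← h1, ← h2, hs1, hs2]
  exact ⟨by ring, rfl⟩

/-- **SZEGŐ'S THEOREM 7.72.1 (discrete form): the extreme Gauss nodes are the extrema of the Rayleigh quotient.**  Let `ν_l > 0` on `N` distinct nodes `w_l`, `t + 1 ≤ N`, and let `(λ, z)`, `λ ≥ 0`,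
`z_0 < ⋯ < z_t`, be exact in degree `≤ 2t + 1`.  Then `z_t` is the GREATEST value of `Σ_l ν_l w_l P(w_l)² ∕ Σ_l ν_l P(w_l)²` over `P ≠ 0` with `deg P ≤ t`, and `z_0` the LEAST (both attained).
[Szegő Thm 7.72.1; Chihara I Ex. 5.7; Courant–Hilbert I §4; this file, §1066] -/
theorem gaussNode_last_isGreatest_rayleigh {t N : ℕ} {μ z : Fin (t + 1) → ℝ} {ν w : Fin N → ℝ} (hν : ∀ l, 0 < ν l) (hw : Function.Injective w) (hN : t + 1 ≤ N)
    (hz : StrictMono z) (hμ : ∀ k, 0 ≤ μ k) (hmom : ∀ p, p ≤ 2 * t + 1 → ∑ k, μ k * z k ^ p = ∑ l, ν l * w l ^ p) :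
    IsGreatest {r : ℝ | ∃ P : ℝ[X], P ≠ 0 ∧ P.natDegree ≤ t ∧ r = (∑ l, ν l * (w l * (P.eval (w l)) ^ 2)) / ∑ l, ν l * (P.eval (w l)) ^ 2} (z (Fin.last t)) ∧
      IsLeast {r : ℝ | ∃ P : ℝ[X], P ≠ 0 ∧ P.natDegree ≤ t ∧ r = (∑ l, ν l * (w l * (P.eval (w l)) ^ 2)) / ∑ l, ν l * (P.eval (w l)) ^ 2} (z 0) := by
  have hpos : ∀ P : ℝ[X], P ≠ 0 → P.natDegree ≤ t → 0 < ∑ l, ν l * (P.eval (w l)) ^ 2 := fun P hP hPd =>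
    sum_mul_eval_sq_pos_of_natDegree_lt hν hw hP (by omega)
  have hLne : ∀ k : Fin (t + 1), Lagrange.basis Finset.univ z k ≠ 0 := fun k h0 => by
    have := natDegree_lagrange_basis_fin hz.injective k
    have h1 := Lagrange.eval_basis_self (v := z) (hz.injective.injOn) (Finset.mem_univ k)
    rw [h0, eval_zero] at h1
    exact zero_ne_one h1
  have hLd : ∀ k : Fin (t + 1), (Lagrange.basis Finset.univ z k).natDegree ≤ t := fun k => (natDegree_lagrange_basis_fin hz.injective k).le
  refine ⟨⟨⟨Lagrange.basis Finset.univ z (Fin.last t), hLne _, hLd _, ?_⟩, ?_⟩, ⟨⟨Lagrange.basis Finset.univ z 0, hLne _, hLd _, ?_⟩, ?_⟩⟩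
  · obtain ⟨h1, -⟩ := rayleigh_eq_at_basis hz hmom (Fin.last t)
    rw [h1, mul_div_assoc, div_self (hpos _ (hLne _) (hLd _)).ne', mul_one]
  · rintro r ⟨P, hP, hPd, rfl⟩
    rw [div_le_iff₀ (hpos P hP hPd)]
    exact rayleigh_le_gaussNode_last hz hμ hmom hPd
  · obtain ⟨h1, -⟩ := rayleigh_eq_at_basis hz hmom 0
    rw [h1, mul_div_assoc, div_self (hpos _ (hLne _) (hLd _)).ne', mul_one]
  · rintro r ⟨P, hP, hPd, rfl⟩
    rw [le_div_iff₀ (hpos P hP hPd)]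
    exact gaussNode_zero_le_rayleigh hz hμ hmom hPd

/-- **MONOTONICITY OF THE EXTREME GAUSS NODES IN THE DEGREE**: if `(λ, z)` with `t + 1` nodes and `(λ′, z′)` with `t′ + 1 ≥ t + 1` nodes are both exact (in degrees `≤ 2t + 1`, `≤ 2t′ + 1`) for the
same positive discrete measure (`N ≥ t + 1` atoms), `λ, λ′ ≥ 0`, then `z′_0 ≤ z_0` and `z_t ≤ z′_{t′}`. [Chihara IV Thm 2.1 ∕ I Ex. 5.7; Szegő Thm 7.72.1; this file, §1066] -/
theorem gaussNode_extreme_mono {t t' N : ℕ} {μ z : Fin (t + 1) → ℝ} {μ' z' : Fin (t' + 1) → ℝ} {ν w : Fin N → ℝ} (hν : ∀ l, 0 < ν l) (hw : Function.Injective w) (hN : t + 1 ≤ N)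
    (htt' : t ≤ t') (hz : StrictMono z) (hz' : StrictMono z') (hμ' : ∀ k, 0 ≤ μ' k) (hmom : ∀ p, p ≤ 2 * t + 1 → ∑ k, μ k * z k ^ p = ∑ l, ν l * w l ^ p)
    (hmom' : ∀ p, p ≤ 2 * t' + 1 → ∑ k, μ' k * z' k ^ p = ∑ l, ν l * w l ^ p) :
    z' 0 ≤ z 0 ∧ z (Fin.last t) ≤ z' (Fin.last t') := by
  have hLd : ∀ k : Fin (t + 1), (Lagrange.basis Finset.univ z k).natDegree ≤ t' := fun k => (natDegree_lagrange_basis_fin hz.injective k).le.trans htt'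
  have hpos : ∀ k : Fin (t + 1), 0 < ∑ l, ν l * ((Lagrange.basis Finset.univ z k).eval (w l)) ^ 2 := fun k =>
    sum_mul_eval_sq_pos_of_natDegree_lt hν hw (fun h0 => by
      have h1 := Lagrange.eval_basis_self (v := z) (hz.injective.injOn) (Finset.mem_univ k)
      rw [h0, eval_zero] at h1
      exact zero_ne_one h1) (by have := natDegree_lagrange_basis_fin hz.injective k; omega)
  constructor
  · obtain ⟨h1, -⟩ := rayleigh_eq_at_basis hz hmom 0
    have h := gaussNode_zero_le_rayleigh hz' hμ' hmom' (hLd 0)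
    rw [h1] at h
    exact le_of_mul_le_mul_right h (hpos 0)
  · obtain ⟨h1, -⟩ := rayleigh_eq_at_basis hz hmom (Fin.last t)
    have h := rayleigh_le_gaussNode_last hz' hμ' hmom' (hLd (Fin.last t))
    rw [h1] at h
    exact le_of_mul_le_mul_right h (hpos _)

/-- **The barycentre lies between the extreme Gauss nodes**: `z_0 · Σ_l ν_l ≤ Σ_l ν_l w_l ≤ z_t · Σ_l ν_l` (take `P = 1`). [Szegő Thm 7.72.1 (case `P = 1`); this file, §1066] -/
theorem gaussNode_zero_le_barycentre_le_last {t N : ℕ} {μ z : Fin (t + 1) → ℝ} {ν w : Fin N → ℝ} (hz : StrictMono z) (hμ : ∀ k, 0 ≤ μ k)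
    (hmom : ∀ p, p ≤ 2 * t + 1 → ∑ k, μ k * z k ^ p = ∑ l, ν l * w l ^ p) :
    z 0 * ∑ l, ν l ≤ ∑ l, ν l * w l ∧ ∑ l, ν l * w l ≤ z (Fin.last t) * ∑ l, ν l := by
  have h1 := gaussNode_zero_le_rayleigh hz hμ hmom (P := 1) (by rw [natDegree_one]; exact Nat.zero_le _)
  have h2 := rayleigh_le_gaussNode_last hz hμ hmom (P := 1) (by rw [natDegree_one]; exact Nat.zero_le _)
  simp only [eval_one, one_pow, mul_one] at h1 h2
  exact ⟨h1, h2⟩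

end Summit.Ventures.HSemireg.Wedge.HankelOuter
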